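import Summits.QuantumFields.BalabanUV.T4Continuum.Support.NE9LinSizeEndRemSpeciesBudget
import Summits.QuantumFields.BalabanUV.T4Continuum.Support.NE9Lemma1RemainderSpeciesAdditive

/-!
# NE9LinSizeEndRemSpeciesAddBudget — N2-sexies (b): the MOST-DISCHARGED d-currency END face of row NE9 at the displayed species —
E5′-REM in print-shaped letters (`NE9LinSizeEndRemSpeciesBudget`, p213373) with the last abstract channel binder, (w16)'s additivity
`PieceAdditiveOn (analyticClass R) Dd.toC`, SUPPLIED BY NAME from `NE9Lemma1RemainderSpeciesAdditive.pieceAdditiveOn_rem` (p213082,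
leaf-08-g4) — cell `pub-balaban`, T4-DAG §2 node U3 / §6 NE9; own-initiative lineage item of unit `b2b-balaban-t4-ne9-formalise-leaf-01`
(gen 5; journal CLAIM before filing), sibling of p213373 (at the 400-line cap); the print-shaped twin of leaf-07-g4's E5′-REM-ADD p213266
(announced open in CLAIMS l.9438, invited by leaf-08-g4 l.9318 «your §2 printed-letter face can get the same one-liner by any seat»).

HONEST FRAMING (T4-DAG PAGE 1).  Rung (B)+1 on a FIXED finite torus — NOT infinite volume, NOT a mass gap, NOT the Clay problem.
ONE END-level composition BY NAME; discharges nothing about Bałaban's objects, asserts nothing printed; NE9 NOT PRINTED / NOT PROVED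
(«NE9 ⇐ the named binders»).  `FlowStep.BetaPertH`, (B), (B^μ) do not occur.  HONEST DEPENDENCY (verbatim): continuum YM on T⁴ ⇐
BetaPertH ∧ nine spine estimates (0/9 proved); BetaPertH ⇐ (D1) ∧ (D4) ∧ CAP+tail; G-an2-4 gates asym, D1 and NE2/3/4.

WHAT IS PROVED (kernel, `[folklore]`, 0 `def`, 0 sorry).  **`torus_termSize_ne9_and_fadingMemory_remSpeciesAdd_printShaped`** = p213373's
`…_remSpecies_printShaped` with `hA ↦ pieceAdditiveOn_rem Dd (0 < κ₁ ⇐ hD.κ₁_ge) hD.r_pos hdirC hdirR`.  After it, WHAT THE d-CURRENCY END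
DISPLAYS AT THE DISPLAYED SPECIES is exactly: the datum's TYPE admissibility `hD : RemData.Admissible` ((I.3.36) domain inclusion, radii,
G1) and scale letter `hℓr`; S1 `hAdm` on the analytic class ([I] (1.18)) and `h0`; the DIRECTION REGULARITY pair `hdirC`/`hdirR` (TYPE
[II] (1.21)/(1.23)); the p. 8 level counts `hLev` and the letters `hO1 hcQ hω`; the recursion side `hfac hlast hρ hΨ hexpl hbase hNsucc hNnn
hbox` (with the EXPONENTIAL-FREE increment `2e(D+1)·2^(2^ν)·2^(ν+1+2^ν)·ε̄` in (N)); the activity / geometry side `hpre hc hpt hint₀ hmeet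
hα4 hα4b hαbar ha hlin hdomconn hdominj hXconn hcmp hε' hε'b hdecayLin ha″`; and the TWO print-shaped scalars — ONE exponential smallness
`hKP : 2^(ν+1)·e·(D+1)·2^(2^ν)·2^(ν+1+2^ν)·ε̄·e^{a″(ν+1)} ≤ 1` and the ADDITIVE `hrate : a″ + 1 + 2^(ν+1)·log 2 + log(8ν) ≤ a′` —, `hℓ hlam`.
NO abstract S-binder (S2/S3/S4/S5 + profile kernel) and NO bookkeeping scalar (`a₁ lip lipbar` chosen) remains; rate letter POLYNOMIAL
and a″-free: `μ⋆ = ω + 8e(D+1)·2^(2^ν)·(2^(ν+1+2^ν))²·ᾱ·ε̄·c_Q`; its T⁴ / print numerals are p213373 §3.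

References (TYPE locators only; nothing printed is a hypothesis): T. Bałaban, CMP **116** (1988) [Balaban1988RG2Cluster] (1.21)–(1.29)
pp. 7–8, p. 18 text, (2.38) p. 20, p. 21 text; CMP **109** (1987) [Balaban1987RG1] (1.18) p. 263, (3.36) p. 277, (3.54) p. 280; R. Kotecký,
D. Preiss, CMP **103** (1986) [KoteckyPreiss1986].
-/

noncomputable section

namespace Summit.QuantumFields.BalabanUV.T4Continuum.NE9LinSizeEndRemSpeciesAddBudget

open scoped BigOperators
open Metric Set MeasureTheory BoundedContinuousFunction
open Literature.Probability.LatticeModels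
open Literature.MathematicalPhysics.QuantumFieldTheory
open Literature.MathematicalPhysics.QuantumFieldTheory.Balaban1983to89
open Literature.MathematicalPhysics.QuantumFieldTheory.Balaban1983to89.T4OutputRate
open Literature.MathematicalPhysics.QuantumFieldTheory.Balaban1983to89.T4ActivityLipschitz
open Literature.MathematicalPhysics.QuantumFieldTheory.Balaban1983to89.T4HistoryLipschitzRecursion
open Literature.MathematicalPhysics.QuantumFieldTheory.Balaban1983to89.T4HistoryLipschitzOuter
open Literature.MathematicalPhysics.QuantumFieldTheory.Balaban1983to89.T4HistoryLipschitzActivity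
open Literature.MathematicalPhysics.QuantumFieldTheory.Balaban1983to89.T4HistoryLipschitzEntropy
open Literature.MathematicalPhysics.QuantumFieldTheory.Balaban1983to89.T4HistoryLipschitzCubeGeometry
open Literature.MathematicalPhysics.QuantumFieldTheory.Balaban1983to89.T4HistoryLipschitzActivity (ClusterGeom)
open Literature.MathematicalPhysics.QuantumFieldTheory.Balaban1983to89.T4HistoryLipschitzSegment
open Literature.MathematicalPhysics.QuantumFieldTheory.Balaban1983to89.T4HistoryLipschitzLinearSize
open Summit.QuantumFields.BalabanUV.T4Continuum.NE9Lemma1Counting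
open Summit.QuantumFields.BalabanUV.T4Continuum.NE9Lemma1Gain
open Summit.QuantumFields.BalabanUV.T4Continuum.NE9Lemma1PieceClass
open Summit.QuantumFields.BalabanUV.T4Continuum.NE9ComplexEncoding (doubleCarriers)
open Summit.QuantumFields.BalabanUV.T4Continuum.NE9Lemma1RemainderSpecies
open Summit.QuantumFields.BalabanUV.T4Continuum.NE9Lemma1RemainderSpeciesAdditive (pieceAdditiveOn_rem)
open Summit.QuantumFields.BalabanUV.T4Continuum.NE9LinSizeEndRemSpeciesBudget

variable {ν N : ℕ} {C : Carriers} {D : ℕ}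
variable {Bg : Type} [NormedAddCommGroup Bg] [NormedSpace ℂ Bg] {Sp : Type*} [TopologicalSpace Sp] [MeasurableSpace Sp]
  [OpensMeasurableSpace Sp] {F : Type*} [Fintype F] {Ω : Type*} [MeasurableSpace Ω]

/-- **THE MOST-DISCHARGED d-CURRENCY END AT THE DISPLAYED SPECIES (kernel, composition BY NAME).**  `NE9LinSizeEndRemSpeciesBudget.
torus_termSize_ne9_and_fadingMemory_remSpecies_printShaped` (p213373: E5′-REM with `a₁ lip lipbar` CHOSEN and `ha₁ hlip hlipb hliplb hsmall
hrate` DISCHARGED from `hKP` + the additive rate) with its displayed additivity `hA : PieceAdditiveOn (analyticClass Dd.R) Dd.toC` SUPPLIED by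
(w16)'s `pieceAdditiveOn_rem` (p213082; `0 < κ₁` from `hD.κ₁_ge`, `r_k > 0` from `hD.r_pos`).  DISPLAYED instead: the direction-regularity pair
`hdirC`/`hdirR` (TYPE [II] (1.21)/(1.23)).  Conclusion VERBATIM p213373's: `TermSize ∧ NE9 E W κ (prodModuli ℓ fun _ => μ⋆) ∧ FadingMemory (ℓ/μ⋆)
μ⋆ (…)`, **`μ⋆ = ω + 8e(D+1)·2^(2^ν)·(2^(ν+1+2^ν))²·ᾱ·ε̄·c_Q`**.
[cite: Balaban1988RG2Cluster, (1.21)-(1.29) pp.7-8, p.18 text, (2.38) p.20, p.21 text; Balaban1987RG1, (1.18) p.263, (3.36) p.277, (3.54) p.280; KoteckyPreiss1986, (1)-(3)] -/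
theorem torus_termSize_ne9_and_fadingMemory_remSpeciesAdd_printShaped
    (Γ : CubeChart (doubleCarriers C) (Fin ν → ZMod N) (torusAdj ν N) D) {ι αi βi γi δ : Type} [DecidableEq δ]
    (Dd : RemData C Bg ι αi βi γi δ) {ℓr : ℕ → ℕ → ℝ} {cdir d0 : ℝ}
    {E : Functional (doubleCarriers C) Bg} {W : Set (ℕ → ℝ)}
    {Ψ : ℕ → ℝ → (ι → ℝ) → Bg → (doubleCarriers C).Dom → ℝ}
    {μ : ℕ → ℝ → Bg → Finset (Fin ν → ZMod N) → Measure Ω} {pre : ℕ → ℝ → Bg → Finset (Fin ν → ZMod N) → Ω → ℂ}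
    {c : ℕ → ℝ → Bg → Finset (Fin ν → ZMod N) → Ω → F → ℂ}
    {pt : ℕ → ℝ → Bg → Finset (Fin ν → ZMod N) → Ω → F → Sp} {β : ℕ → Sp → ℝ}
    {dom : ℕ → Finset (Fin ν → ZMod N) → F → Finset (Fin ν → ZMod N)}
    {ε' α4 : ℕ → ℝ} {a'' κ O1 cQ ω ℓ a a' εbar αbar : ℝ}
    {lam p₀ Nsz : ℕ → ℝ}
    (ρ : ℕ → (ι → ℝ) → (Sp →ᵇ ℂ))
    -- the DISPLAYED SPECIES: admissible datum ((I.3.36) domain inclusion, radii, G1 — TYPE), scale letter ℓr ≥ 0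
    (hD : Dd.Admissible ℓr cdir d0) (hℓr : ∀ k j, 0 ≤ ℓr k j)
    -- S1 on the analytic class ([I] (1.18) — TYPE), scale-zero freeness, the p. 8 counts and letters
    (h0 : ScaleZeroFree E W) (hAdm : AdmissibleTerms E W (analyticClass Dd.R))
    -- S3's residue: DIRECTION REGULARITY of the contour directions (TYPE [II] (1.21)/(1.23) p. 7) — (w16) `pieceAdditiveOn_rem`
    (hdirC : ∀ k s y a b x, Continuous fun p : ℂ × (δ → ℝ) × (δ → ℂ) => Dd.dir k s y a b x p.1 p.2.1 p.2.2)
    (hdirR : ∀ k s y a b x t s' σ', ‖Dd.dir k s y a b x t s' σ'‖ < Dd.R x.1)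
    (hLev : LevelCountsG Dd.toC.frame κ Dd.κ₁ O1 cQ (fun k j => ℓr k j ^ 5) (agePow ω))
    (hO1 : 0 ≤ O1) (hcQ : 0 ≤ cQ) (hω : 0 < ω)
    -- E5′'s recursion-side binders at `T := cpieceChannel Dd.toC`, `wt := weightOf Dd.toC.frame Dd.κ₁ d0 O1 (KpOf Dd cdir)` (verbatim)
    (hfac : Factorises E W (cpieceChannel Dd.toC) Ψ) (hlast : LastCouplingLipschitz E W (cpieceChannel Dd.toC) Ψ κ lam)
    (hρ : ∀ (k : ℕ) (Q Q' : ι → ℝ) (M : ℝ), (∀ y, |Q y - Q' y| ≤ weightOf Dd.toC.frame Dd.κ₁ d0 O1 (KpOf Dd cdir) k y * M) →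
      ‖ρ k Q - ρ k Q'‖ ≤ M)
    (hΨ : ∀ (k : ℕ) (s : ℝ) (Q Q' : ι → ℝ) (U : Bg) (X : (doubleCarriers C).Dom),
      Ψ k s Q U X - Ψ k s Q' U X =
        (Γ.geom.newTerm (Γ.geom.avgExpLinearAct μ pre fun k s U γ ω => evalFunctional (c k s U γ ω) (pt k s U γ ω))
            k s U X (ρ k Q) -
          Γ.geom.newTerm (Γ.geom.avgExpLinearAct μ pre fun k s U γ ω => evalFunctional (c k s U γ ω) (pt k s U γ ω))
            k s U X (ρ k Q')).re)
    (hexpl : ∀ g ∈ W, ∀ (k : ℕ) (Q : ι → ℝ) (U : Bg) (X : (doubleCarriers C).Dom), (doubleCarriers C).scale X = k + 1 →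
      |Ψ k (g k) Q U X -
          (Γ.geom.newTerm (Γ.geom.avgExpLinearAct μ pre fun k s U γ ω => evalFunctional (c k s U γ ω) (pt k s U γ ω))
            k (g k) U X (ρ k Q)).re| ≤ Real.exp (-(κ * (doubleCarriers C).d X)) * p₀ k)
    (hbase : ∀ g ∈ W, ∀ (U : Bg) (X : (doubleCarriers C).Dom), (doubleCarriers C).scale X = 0 →
      |E g U X| ≤ Real.exp (-(κ * (doubleCarriers C).d X)) * Nsz 0)
    -- (N) with the EXPONENTIAL-FREE increment B = 2e(D+1)·2^(2^ν)·2^(ν+1+2^ν)·ε̄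
    (hNsucc : ∀ j, p₀ j + 2 * Real.exp 1 * ((D : ℝ) + 1) * (2:ℝ) ^ (2 ^ ν) * 2 ^ (ν + 1 + 2 ^ ν) * εbar ≤ Nsz (j + 1))
    (hNnn : ∀ j, 0 ≤ Nsz j)
    (hbox : ∀ (k : ℕ) (Q : ι → ℝ),
      (∀ y, |Q y| ≤ weightOf Dd.toC.frame Dd.κ₁ d0 O1 (KpOf Dd cdir) k y * sizeRadius (tauOfG cQ (agePow ω)) Nsz k) →
        ∀ x, ‖ρ k Q x‖ ≤ β k x)
    -- activity side: regularity data, ONE integrability, support of the coefficients (verbatim)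
    (hpre : ∀ k s U γ, AEStronglyMeasurable (pre k s U γ) (μ k s U γ))
    (hc : ∀ k s U γ Y, AEStronglyMeasurable (fun ω => c k s U γ ω Y) (μ k s U γ))
    (hpt : ∀ k s U γ Y, Measurable fun ω => pt k s U γ ω Y)
    (hint₀ : ∀ k s U γ, Integrable (fun ω => ‖pre k s U γ ω‖ * Real.exp (boxExponent c pt β k s U γ ω)) (μ k s U γ))
    (hmeet : ∀ k s U (γ : Finset (Fin ν → ZMod N)) ω Y, c k s U γ ω Y ≠ 0 → ∃ x ∈ γ, x ∈ dom k γ Y)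
    -- (L‴) the coefficient tables with a SUP LETTER ᾱ for their scale (TYPE [II] (2.20): α₄ is one constant)
    (hα4 : ∀ k, 0 ≤ α4 k) (hα4b : ∀ k, α4 k ≤ αbar) (hαbar : 0 < αbar)
    (ha : (2:ℝ) ^ ν * Real.log 2 + Real.log (8 * ν) ≤ a)
    (hlin : ∀ k s U (γ : Finset (Fin ν → ZMod N)) ω Y,
      ‖c k s U γ ω Y‖ ≤ α4 k * Real.exp (-(a * (linSize (dom k γ Y) : ℝ))))
    (hdomconn : ∀ k (γ : Finset (Fin ν → ZMod N)) Y, (dom k γ Y).Nonempty →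
      ∃ b ∈ dom k γ Y, Polymer.IsConn (torusAdj ν N) (dom k γ Y) b)
    (hdominj : ∀ k (γ : Finset (Fin ν → ZMod N)), Set.InjOn (dom k γ) {Y | (dom k γ Y).Nonempty})
    (hXconn : ∀ X, ∃ b, Polymer.IsConn (torusAdj ν N) (Γ.cubes X) b)
    (hcmp : ∀ X, κ * (doubleCarriers C).d X ≤ a'' * (linSize (Γ.cubes X) : ℝ))
    -- (A″) the box majorant in d_k with a SUP LETTER ε̄ for its scale (ε₁ is one constant)
    (hε' : ∀ k, 0 ≤ ε' k) (hε'b : ∀ k, ε' k ≤ εbar)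
    (hdecayLin : ∀ g ∈ W, ∀ (k : ℕ) (U : Bg) (X : (doubleCarriers C).Dom), (doubleCarriers C).scale X = k + 1 → ∀ γ' ∈ Γ.vol X,
      ∫ ω, ‖pre k (g k) U γ' ω‖ * Real.exp (boxExponent c pt β k (g k) U γ' ω) ∂(μ k (g k) U γ') ≤
        ε' k * Real.exp (-(a' * (linSize γ' : ℝ))))
    (ha'' : 0 ≤ a'')
    -- THE PRINT-SHAPED SCALARS: the one exponential smallness and the ADDITIVE letter-free rate condition
    (hKP : 2 ^ (ν + 1) * Real.exp 1 * ((D : ℝ) + 1) * (2:ℝ) ^ (2 ^ ν) * 2 ^ (ν + 1 + 2 ^ ν) * εbar *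
      Real.exp (a'' * (ν + 1)) ≤ 1)
    (hrate : a'' + 1 + 2 ^ (ν + 1) * Real.log 2 + Real.log (8 * ν) ≤ a')
    (hℓ : 0 ≤ ℓ) (hlam : ∀ k, lam k ≤ ℓ) :
    TermSize E W κ Nsz ∧
      NE9 E W κ (prodModuli ℓ fun _ =>
        ω + 8 * Real.exp 1 * ((D : ℝ) + 1) * (2:ℝ) ^ (2 ^ ν) * (2 ^ (ν + 1 + 2 ^ ν)) ^ 2 * αbar * εbar * cQ) ∧
        FadingMemory
          (ℓ / (ω + 8 * Real.exp 1 * ((D : ℝ) + 1) * (2:ℝ) ^ (2 ^ ν) * (2 ^ (ν + 1 + 2 ^ ν)) ^ 2 * αbar * εbar * cQ))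
          (ω + 8 * Real.exp 1 * ((D : ℝ) + 1) * (2:ℝ) ^ (2 ^ ν) * (2 ^ (ν + 1 + 2 ^ ν)) ^ 2 * αbar * εbar * cQ)
          (prodModuli ℓ fun _ =>
            ω + 8 * Real.exp 1 * ((D : ℝ) + 1) * (2:ℝ) ^ (2 ^ ν) * (2 ^ (ν + 1 + 2 ^ ν)) ^ 2 * αbar * εbar * cQ) :=
  torus_termSize_ne9_and_fadingMemory_remSpecies_printShaped Γ Dd ρ hD hℓr h0 hAdm
    (pieceAdditiveOn_rem Dd (lt_of_lt_of_le zero_lt_one hD.κ₁_ge) hD.r_pos hdirC hdirR) hLev hO1 hcQ hω hfac hlast hρ hΨ hexpl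
    hbase hNsucc hNnn hbox hpre hc hpt hint₀ hmeet hα4 hα4b hαbar ha hlin hdomconn hdominj hXconn hcmp hε' hε'b hdecayLin ha''
    hKP hrate hℓ hlam

end Summit.QuantumFields.BalabanUV.T4Continuum.NE9LinSizeEndRemSpeciesAddBudget

end
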